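import Summits.Ventures.PercRepro.PerLineClosing

/-!
# PercRepro — Theorem N Step 2 (N5), part B: the per-line closing and the assembly `phiTwo_mul_card_Up_le′` (p2, gen 5; split gen 6)

Continuation of `PerLineClosing.lean` (split for the 400-line file limit; proofs unchanged).
-/

namespace PercRepro

namespace ThmN

open Finset ThmH BinomialLayer

/-! ### The per-line closing -/

section Closing

variable {α : Type*} [DecidableEq α] {M : Matroid α} [M.Finite]

/-- `Φ(p, 2) ≥ 0`. -/
theorem phiTwo_nonneg (p : ℕ) : 0 ≤ phiTwo p := by
  unfold phiTwo
  positivity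

/-- On a line with at least four points and `|E ∖ L| = p − 1`, the eligible sum is `Σ_{b=2}^{ℓ} C(ℓ, b)·F(p, b)`. -/
theorem sum_Elig_eq_of_four_le (hs : Simple M) {p : ℕ} (hpE : ((p : ℕ) : ℕ∞) ≤ M.eRank) {L : Finset α}
    (hL : L ∈ lines M) (hℓ : 4 ≤ L.card) (hn : (gr M \ L).card = p - 1) :
    ∑ B ∈ Elig M p L, Fn p (gr M \ L).card B.card =
      ∑ b ∈ Finset.Icc 2 L.card, (L.card.choose b : ℚ) * F p b := by
  classical
  rw [Elig_eq_of_four_le hs hpE hL hℓ, hn]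
  have hmaps : ∀ B ∈ L.powerset.filter (fun B => 2 ≤ B.card), B.card ∈ Finset.Icc 2 L.card := by
    intro B hB
    rw [Finset.mem_filter, Finset.mem_powerset] at hB
    rw [Finset.mem_Icc]
    exact ⟨hB.2, Finset.card_le_card hB.1⟩
  rw [← Finset.sum_fiberwise_of_maps_to' hmaps (fun b => Fn p (p - 1) b)]
  apply Finset.sum_congr rfl
  intro b hb
  rw [Finset.mem_Icc] at hb
  rw [Finset.sum_const, nsmul_eq_mul, Fn_eq_F]
  congr 1
  have hcard : (L.powerset.filter (fun B => 2 ≤ B.card)).filter (fun B => B.card = b) = L.powersetCard b := by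
    rw [Finset.powersetCard_eq_filter, Finset.filter_filter]
    apply Finset.filter_congr
    intro B _
    constructor
    · exact fun h => h.2
    · intro h; exact ⟨by omega, h⟩
  rw [hcard, Finset.card_powersetCard]

/-- **(N5) — the per-line closing**: for a simple matroid with `ρ(E) ≥ p ≥ 4`, coloop-free when `ρ(E) = p`, and
the `D(ℓ)` inequality `hD` (typer-2's (N2)), every line satisfies `Φ(p, 2)·#U′_L ≤ Σ_{B′ ∈ Elig(L)} F_{|E ∖ L|}(|B′|)`. -/
theorem perLine_closing (hs : Simple M) {p : ℕ} (hp4 : 4 ≤ p) (hpE : ((p : ℕ) : ℕ∞) ≤ M.eRank)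
    (hcol : M.eRank = (p : ℕ) → ∀ e, ¬ M.IsColoop e)
    (hD : ∀ ℓ : ℕ, 4 ≤ ℓ →
      phiTwo p * ((2 : ℚ) ^ ℓ - ℓ - 2) ≤ ∑ b ∈ Finset.Icc 2 ℓ, (ℓ.choose b : ℚ) * F p b)
    {L : Finset α} (hL : L ∈ lines M) :
    phiTwo p * ((UpL M p L).card : ℚ) ≤ ∑ B ∈ Elig M p L, Fn p (gr M \ L).card B.card := by
  classical
  have hphi := phiTwo_nonneg p
  have hn1 := card_sdiff_line_ge hp4 hpE hcol hL
  have hℓ2 := two_le_card_of_mem_lines hL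
  have hsubElig := UpL_subset_Elig M p L
  rcases lt_or_ge (gr M \ L).card p with hn | hn
  · -- |E ∖ L| = p − 1
    have hLnot := line_notMem_UpL (M := M) (p := p) (L := L) hn
    rcases lt_or_ge L.card 4 with hℓ | hℓ
    · rcases Nat.eq_or_lt_of_le hℓ2 with hℓ2' | hℓ3
      · -- |L| = 2: U′_L = ∅
        have hempty : UpL M p L = ∅ := by
          rw [Finset.eq_empty_iff_forall_notMem]
          intro B hB
          have hB' := hB
          simp only [UpL, Finset.mem_filter, Finset.mem_powerset] at hB'
          have : B = L := Finset.eq_of_subset_of_card_le hB'.1 (by omega)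
          subst this
          exact hLnot hB
        rw [hempty, Finset.card_empty, Nat.cast_zero, mul_zero]
        exact Finset.sum_nonneg (fun B _ => Fn_nonneg _ _ _)
      · -- |L| = 3: U′_L consists of pairs, L is eligible once U′_L ≠ ∅
        have hℓ3' : L.card = 3 := by omega
        have hpairs : ∀ B ∈ UpL M p L, B.card = 2 := by
          intro B hB
          have hB' := hB
          simp only [UpL, Finset.mem_filter, Finset.mem_powerset] at hB'
          have hlt : B.card < L.card := by
            rcases Nat.lt_or_ge B.card L.card with h | h
            · exact h
            · exact absurd (Finset.eq_of_subset_of_card_le hB'.1 h) (fun e => hLnot (e ▸ hB))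
          omega
        have hu3 : (UpL M p L).card ≤ 3 := by
          have : UpL M p L ⊆ L.powersetCard 2 := by
            intro B hB
            rw [Finset.mem_powersetCard]
            exact ⟨(Finset.mem_filter.1 hB).1 |> Finset.mem_powerset.1, hpairs B hB⟩
          have := Finset.card_le_card this
          rwa [Finset.card_powersetCard, hℓ3'] at this
        rcases Finset.eq_empty_or_nonempty (UpL M p L) with hempty | ⟨B₀, hB₀⟩
        · rw [hempty, Finset.card_empty, Nat.cast_zero, mul_zero]
          exact Finset.sum_nonneg (fun B _ => Fn_nonneg _ _ _)
        · have hLElig : L ∈ Elig M p L := by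
            have hB₀' := hsubElig hB₀
            simp only [Elig, Finset.mem_filter, Finset.mem_powerset] at hB₀' ⊢
            obtain ⟨hB₀L, -, a, ha, b, hb, hab, hco⟩ := hB₀'
            exact ⟨subset_refl _, by omega, a, hB₀L ha, b, hB₀L hb, hab, hco⟩
          have hsub2 : insert L (UpL M p L) ⊆ Elig M p L := by
            intro B hB
            rw [Finset.mem_insert] at hB
            rcases hB with rfl | hB
            · exact hLElig
            · exact hsubElig hB
          have hn' : (gr M \ L).card = p - 1 := by omega
          calc phiTwo p * ((UpL M p L).card : ℚ)
              ≤ ∑ B ∈ insert L (UpL M p L), Fn p (gr M \ L).card B.card := by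
                rw [Finset.sum_insert hLnot, hℓ3', Finset.sum_congr rfl (fun B hB => by rw [hpairs B hB]),
                  Finset.sum_const, nsmul_eq_mul, hn', Fn_eq_F, Fn_eq_F]
                have h1 := F_two_le_phiTwo p hp4
                have h2 := three_phiTwo_le p hp4
                have hu : ((UpL M p L).card : ℚ) ≤ 3 := by exact_mod_cast hu3
                have hu0 : (0 : ℚ) ≤ ((UpL M p L).card : ℚ) := by positivity
                nlinarith
            _ ≤ ∑ B ∈ Elig M p L, Fn p (gr M \ L).card B.card :=
                Finset.sum_le_sum_of_subset_of_nonneg hsub2 (fun B _ _ => Fn_nonneg _ _ _)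
    · -- |L| ≥ 4: every pair is coindependent, D(ℓ) closes
      have hn' : (gr M \ L).card = p - 1 := by omega
      rw [sum_Elig_eq_of_four_le hs hpE hL hℓ hn']
      have hcount := card_UpL_add_one_le hL hn
      have hpow := card_ge_two_add L
      have hu : ((UpL M p L).card : ℚ) ≤ (2 : ℚ) ^ L.card - L.card - 2 := by
        have : (UpL M p L).card + L.card + 2 ≤ 2 ^ L.card := by omega
        have h' : (((UpL M p L).card + L.card + 2 : ℕ) : ℚ) ≤ ((2 ^ L.card : ℕ) : ℚ) := by exact_mod_cast this
        push_cast at h'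
        linarith
      calc phiTwo p * ((UpL M p L).card : ℚ) ≤ phiTwo p * ((2 : ℚ) ^ L.card - L.card - 2) :=
            mul_le_mul_of_nonneg_left hu hphi
        _ ≤ _ := hD L.card hℓ
  · -- |E ∖ L| ≥ p: monotonicity
    calc phiTwo p * ((UpL M p L).card : ℚ) = ∑ B ∈ UpL M p L, phiTwo p := by
          rw [Finset.sum_const, nsmul_eq_mul, mul_comm]
      _ ≤ ∑ B ∈ UpL M p L, Fn p (gr M \ L).card B.card := by
          apply Finset.sum_le_sum
          intro B hB
          have hB2 : 2 ≤ B.card := (Finset.mem_filter.1 hB).2.1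
          calc phiTwo p = Fn p p 2 := (Fn_two_eq_phiTwo p (by omega)).symm
            _ ≤ Fn p p B.card := Fn_mono_b (le_refl 2) hB2 p p
            _ ≤ Fn p (gr M \ L).card B.card := Fn_mono_n hn p B.card
      _ ≤ ∑ B ∈ Elig M p L, Fn p (gr M \ L).card B.card :=
          Finset.sum_le_sum_of_subset_of_nonneg hsubElig (fun B _ _ => Fn_nonneg _ _ _)

end Closing

/-! ### Assembly: (RLS)(p, 2) on the finset level, modulo `D(ℓ)` -/

section Assembly

variable {α : Type*} [DecidableEq α] {M : Matroid α} [M.Finite]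

/-- **Theorem N, Step 2 assembled (finset level)**: for a simple matroid with `ρ(E) ≥ p ≥ 4`, coloop-free when
`ρ(E) = p`, and the `D(ℓ)` inequality, `Φ(p, 2)·#U′ ≤ #Y′` with `U′ = {B ⊆ E : ρ(B) = 2, ρ(E ∖ B) ≥ p}` and
`Y′ = {S ⊆ E : 2 < ρ(S) < p}`. -/
theorem phiTwo_mul_card_Up_le (hs : Simple M) {p : ℕ} (hp4 : 4 ≤ p) (hpE : ((p : ℕ) : ℕ∞) ≤ M.eRank)
    (hcol : M.eRank = (p : ℕ) → ∀ e, ¬ M.IsColoop e)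
    (hD : ∀ ℓ : ℕ, 4 ≤ ℓ →
      phiTwo p * ((2 : ℚ) ^ ℓ - ℓ - 2) ≤ ∑ b ∈ Finset.Icc 2 ℓ, (ℓ.choose b : ℚ) * F p b) :
    phiTwo p * ((Up M p).card : ℚ) ≤ ((Yp M p).card : ℚ) :=
  mul_card_Up_le_of_perLine hs p (phiTwo_nonneg p) (fun _ hL => perLine_closing hs hp4 hpE hcol hD hL)

/-- The per-line closing with typer-2's `D_lemma` discharging `hD`. -/
theorem perLine_closing' (hs : Simple M) {p : ℕ} (hp4 : 4 ≤ p) (hpE : ((p : ℕ) : ℕ∞) ≤ M.eRank)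
    (hcol : M.eRank = (p : ℕ) → ∀ e, ¬ M.IsColoop e) {L : Finset α} (hL : L ∈ lines M) :
    phiTwo p * ((UpL M p L).card : ℚ) ≤ ∑ B ∈ Elig M p L, Fn p (gr M \ L).card B.card :=
  perLine_closing hs hp4 hpE hcol (fun ℓ hℓ => D_lemma p ℓ hp4 hℓ) hL

/-- **Theorem N, Step 2 (finset level), unconditional**: for a simple matroid with `ρ(E) ≥ p ≥ 4`, coloop-free when
`ρ(E) = p`: `Φ(p, 2)·#U′ ≤ #Y′`. -/
theorem phiTwo_mul_card_Up_le' (hs : Simple M) {p : ℕ} (hp4 : 4 ≤ p) (hpE : ((p : ℕ) : ℕ∞) ≤ M.eRank)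
    (hcol : M.eRank = (p : ℕ) → ∀ e, ¬ M.IsColoop e) :
    phiTwo p * ((Up M p).card : ℚ) ≤ ((Yp M p).card : ℚ) :=
  phiTwo_mul_card_Up_le hs hp4 hpE hcol (fun ℓ hℓ => D_lemma p ℓ hp4 hℓ)

end Assembly

end ThmN

end PercRepro
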